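import Summits.CriticalPhenomena.SAWScalingLimit.Theorems.SAWSpinMonotoneQCIdentificationXiLift
import Summits.CriticalPhenomena.SAWScalingLimit.Theorems.SAWSpinMonotoneQCIdentificationStokes
import Literature.Probability.LatticeModels.ExplorationPathProofs

/-!
# Smirnov's primitive `Ξ = F^{8/5} dz`, V-a: arcs of a face set around a site and walks avoiding a
face (toolkit for the single boundary cycle; helper sub-goal (O) of `stub_rayCondition`, line
`eight_fifths_primitive`, crux `QCIdentification`, stmt-CriticalPhenomena-16772)

**Setting.** A finite set `X` of faces of `𝕋` (vertices of `ℍ`, `HexVertex`); around a site `s`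
the six faces `HexKernel.face s 0, …, face s 5`; an ARC of `X` at `s` is a maximal run
`face s (j+1), …, face s (j+m)` (`m ≠ 0`) of faces of `X` flanked by `face s j ∉ X` and
`face s (j+1+m) ∉ X`; its out-flank port `(face s (j+1), arcCornerIdx (j+1) + 1)` points to
`face s j` and its in-flank port `(face s (j+m), arcCornerIdx (j+m))` to `face s (j+1+m)`
(`NB.hexNbr_face_arcCornerIdx(_succ)`).  The boundary ports of `X` (`v ∈ X`, `hexNbr v k ∉ X`),
linked by "in-flank ∼ out-flank of the same arc", form ONE cycle when `X` is connected in `ℍ` with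
connected complement; the sibling files `…XiCycleStep`, `…XiCycle` prove this by induction on `|X|`
removing the topmost face.  This file is the toolkit of that induction:

* `Fin 6` / `Fin 3` bookkeeping (`decide`; the `Fin 3` port trichotomy is `fin3_trichotomy` of
  `ExplorationPathProofs`, `fin3_add_one_add_one`, `fin3_add_two_add_one` of `TriDiscInterface`);
* `site_eq_of_face_eq`: a face and a corner index determine the site (`face s l = face s' l'` and
  `arcCornerIdx l = arcCornerIdx l'` force `s = s'`, `l = l'`);
* existence and uniqueness of arcs: `xi_exists_arc_from` (registered; the arc starting after a
  non-member), `exists_arc_to` (ending before one), `arc_unique_start`, `arc_unique_end`;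
* walks: `reflTransGen_of_walk`, `exists_hexNbr_reachable_erase` (a walk to `v` inside `T` reaches a
  `T`-neighbour of `v` before, inside `T ∖ {v}`), `preconnected_erase_of`, `eq_of_isolated`,
  the components `NB.srcComp` of `T ∖ {v}` (`srcComp_preconnected`, `mem_srcComp_or_of_erase`);
* links: `corner_link` (a face with two consecutive outer ports: the one-face arc links them),
  `const_of_isolated`, and `links_transfer` — the flank condition of `T` passes to a sub-face-set
  `X ⊆ T ∖ {v}` closed under `T ∖ {v}`-adjacency for the function modified on the ports pointing
  into `v`, GIVEN the two local obligations at arcs flanked by `v`.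

Sources: folklore (boundary cycles of planar face complexes); H. Duminil-Copin, S. Smirnov, Ann. of
Math. 175 (2012) 1653–1665, §3; the stub report `STUB-REPORT-rayCondition.md` ((O)) of this line.
Conventions validated by enumeration (`work/stubs/scratch_xi/cycle_induction_check.py`: 2 859 face
sets, all four induction cases).
-/

noncomputable section

open Literature.Probability.LatticeModels Literature.Probability.RandomPlanarGeometry
open Literature.Probability.RandomPlanarGeometry.SAW
open Literature.Barriers.CriticalPhenomena Literature.Barriers.CriticalPhenomena.HexKernel

namespace Summit.CriticalPhenomena.SAWScalingLimit.Cruxes.QCIdentification.EightFifthsPrimitive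

namespace Xi

open NB Stokes
open Literature.Probability.Percolation.TriMarkedDomain (fin3_add_one_add_one fin3_add_two_add_one)

/-! ### `Fin 6` and `Fin 3` bookkeeping -/

/-- Splitting an index below `m + 1 + m'` into the three pieces of a concatenated run. -/
theorem fin6_lt_add_one_add (m m' i : Fin 6) (h : i < m + 1 + m') :
    i < m ∨ i = m ∨ ∃ i' : Fin 6, i' < m' ∧ i = m + 1 + i' := by
  revert m m' i; decide

/-- Backwards indices stay below the length. -/
theorem fin6_sub_one_sub_lt (n i : Fin 6) (h : i < n) : n - 1 - i < n := by revert n i; decide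

/-- `l - 1 + m = l` forces `m = 1`. -/
theorem fin6_eq_one_of (l m : Fin 6) (h : l - 1 + m = l) : m = 1 := by revert l m; decide

/-- The complementary piece of a longer run is a proper piece. -/
theorem fin6_sub_lt_of_lt (m m' : Fin 6) (h : m < m') : m' - 1 - m < m' := by revert m m'; decide

/-- Nothing lies below `0`. -/
theorem fin6_not_lt_zero (i : Fin 6) : ¬i < 0 := by revert i; decide
/-- Below `1` there is only `0`. -/
theorem fin6_lt_one (i : Fin 6) (h : i < 1) : i = 0 := by revert i; decide

/-- `a ≠ a + 1` in `Fin 3` (the relative position of the three ports `a`, `a + 1`, `a + 2` is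
`fin3_trichotomy`, `TriMarkedDomain.fin3_add_one_add_one`, `TriMarkedDomain.fin3_add_two_add_one`). -/
theorem fin3_ne_add_one (a : Fin 3) : a ≠ a + 1 := by revert a; decide

/-! ### Sites and corners -/

/-- **A face and a corner determine the site.** If `face s l = face s' l'` and the two corner
indices agree, then `s = s'` and `l = l'` (the three hexagons through a face sit at its three
corners, of pairwise different corner indices `arcCornerIdx`). -/
theorem site_eq_of_face_eq {s s' : Site 2} {l l' : Fin 6} (h : face s l = face s' l')
    (hκ : arcCornerIdx l = arcCornerIdx l') : s = s' ∧ l = l' := by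
  fin_cases l <;> fin_cases l' <;> simp_all [face, arcCornerIdx]

/-- Ports are determined by their far endpoint: `hexNbr v i = hexNbr v j → i = j`. -/
theorem hexNbr_inj {v : HexVertex} {i j : Fin 3} (h : hexNbr v i = hexNbr v j) : i = j := by
  by_contra hne
  exact hexNbr_ne v hne h

/-! ### Arcs: existence and uniqueness -/

/-- **The arc after a non-member (registered).** If `face s j ∉ X` and `face s (j+1) ∈ X`, the run
of faces of `X` starting at `face s (j+1)` is an arc: for some `m ≠ 0` the faces
`face s (j+1+i)`, `i < m`, lie in `X` and `face s (j+1+m)` does not. -/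
theorem xi_exists_arc_from : ∀ (X : Finset HexVertex) (s : Site 2) (j : Fin 6), HexKernel.face s j ∉ X → HexKernel.face s (j + 1) ∈ X → ∃ m : Fin 6, m ≠ 0 ∧ (∀ i : Fin 6, i < m → HexKernel.face s (j + 1 + i) ∈ X) ∧ HexKernel.face s (j + 1 + m) ∉ X := by
  classical
  intro X s j hj hj1
  set P : Finset (Fin 6) := Finset.univ.filter fun m => face s (j + 1 + m) ∉ X with hP
  have h5 : (5 : Fin 6) ∈ P := by
    refine Finset.mem_filter.2 ⟨Finset.mem_univ _, ?_⟩
    rwa [(by decide : ∀ j : Fin 6, j + 1 + 5 = j) j]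
  obtain ⟨m, hm, hmin⟩ := P.exists_min_image id ⟨5, h5⟩
  have hmP : face s (j + 1 + m) ∉ X := (Finset.mem_filter.1 hm).2
  refine ⟨m, ?_, fun i hi => ?_, hmP⟩
  · rintro rfl
    exact hmP (by simpa using hj1)
  · by_contra h
    exact (lt_irrefl _) (lt_of_lt_of_le hi (hmin i (Finset.mem_filter.2 ⟨Finset.mem_univ _, h⟩)))

/-- **The arc before a non-member.** If `face s l ∉ X` and `face s (l-1) ∈ X`, the run of faces of
`X` ending at `face s (l-1)` is an arc `face s (j+1), …, face s (j+m)` with `j + 1 + m = l`. -/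
theorem exists_arc_to (X : Finset HexVertex) (s : Site 2) (l : Fin 6) (hl : face s l ∉ X)
    (hl1 : face s (l - 1) ∈ X) : ∃ j m : Fin 6, m ≠ 0 ∧ face s j ∉ X ∧
      (∀ i : Fin 6, i < m → face s (j + 1 + i) ∈ X) ∧ j + 1 + m = l := by
  classical
  set P : Finset (Fin 6) := Finset.univ.filter fun n => face s (l - 1 - n) ∉ X with hP
  have h5 : (5 : Fin 6) ∈ P := by
    refine Finset.mem_filter.2 ⟨Finset.mem_univ _, ?_⟩
    rwa [(by decide : ∀ l : Fin 6, l - 1 - 5 = l) l]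
  obtain ⟨n, hn, hmin⟩ := P.exists_min_image id ⟨5, h5⟩
  have hnP : face s (l - 1 - n) ∉ X := (Finset.mem_filter.1 hn).2
  refine ⟨l - 1 - n, n, ?_, hnP, fun i hi => ?_, by abel⟩
  · rintro rfl
    exact hnP (by simpa using hl1)
  · by_contra h
    have hmem : n - 1 - i ∈ P := by
      refine Finset.mem_filter.2 ⟨Finset.mem_univ _, ?_⟩
      rwa [show l - 1 - (n - 1 - i) = l - 1 - n + 1 + i by abel]
    exact (lt_irrefl _) (lt_of_lt_of_le (fin6_sub_one_sub_lt n i hi) (hmin _ hmem))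

/-- **Arcs with the same start coincide.** -/
theorem arc_unique_start {X : Finset HexVertex} {s : Site 2} {j m m' : Fin 6}
    (hi : ∀ i : Fin 6, i < m → face s (j + 1 + i) ∈ X) (hm : face s (j + 1 + m) ∉ X)
    (hi' : ∀ i : Fin 6, i < m' → face s (j + 1 + i) ∈ X) (hm' : face s (j + 1 + m') ∉ X) :
    m = m' := by
  rcases lt_trichotomy m m' with h | h | h
  · exact absurd (hi' m h) hm
  · exact h
  · exact absurd (hi m' h) hm'

/-- **Arcs with the same end coincide.** -/
theorem arc_unique_end {X : Finset HexVertex} {s : Site 2} {j j' m m' : Fin 6}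
    (hj : face s j ∉ X) (hi : ∀ i : Fin 6, i < m → face s (j + 1 + i) ∈ X)
    (hj' : face s j' ∉ X) (hi' : ∀ i : Fin 6, i < m' → face s (j' + 1 + i) ∈ X)
    (he : j + 1 + m = j' + 1 + m') : j = j' := by
  rcases lt_trichotomy m m' with h | h | h
  · refine absurd ?_ hj
    have e : j = j' + 1 + (m' - 1 - m) := by
      rw [show j = j + 1 + m - 1 - m by abel, he]; abel
    rw [e]
    exact hi' _ (fin6_sub_lt_of_lt m m' h)
  · subst h
    simpa using he
  · refine absurd ?_ hj'
    have e : j' = j + 1 + (m - 1 - m') := by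
      rw [show j' = j' + 1 + m' - 1 - m' by abel, ← he]; abel
    rw [e]
    exact hi _ (fin6_sub_lt_of_lt m' m h)

/-! ### Walks -/

/-- A walk in the subgraph induced on `X` is a chain of adjacent faces of `X`. -/
theorem reflTransGen_of_walk {X : Finset HexVertex} :
    ∀ (a b : (↑X : Set HexVertex)) (_ : (hexGraph.induce (↑X : Set HexVertex)).Walk a b),
      Relation.ReflTransGen (fun p q : HexVertex => p ∈ X ∧ q ∈ X ∧ hexGraph.Adj p q) a.1 b.1 := by
  intro a b p
  induction p with
  | nil => exact Relation.ReflTransGen.refl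
  | @cons x y z hxy _ ih =>
    exact Relation.ReflTransGen.head ⟨Finset.mem_coe.1 x.2, Finset.mem_coe.1 y.2,
      SimpleGraph.induce_adj.1 hxy⟩ ih

/-- **A walk to `v` inside `T` passes through a `T`-neighbour of `v`**, which is reached from the
start inside `T ∖ {v}`. -/
theorem exists_hexNbr_reachable_erase {T : Finset HexVertex} {v : HexVertex} :
    ∀ (x y : (↑T : Set HexVertex)) (_ : (hexGraph.induce (↑T : Set HexVertex)).Walk x y),
      y.1 = v → x.1 ≠ v → ∃ (k : Fin 3) (hk : hexNbr v k ∈ T.erase v) (hx : x.1 ∈ T.erase v),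
        (hexGraph.induce (↑(T.erase v) : Set HexVertex)).Reachable ⟨x.1, Finset.mem_coe.2 hx⟩
          ⟨hexNbr v k, Finset.mem_coe.2 hk⟩ := by
  intro x y p
  induction p with
  | nil => intro hy hx; exact absurd hy hx
  | @cons a b c hab _ ih =>
    intro hc ha
    have hab' : hexGraph.Adj a.1 b.1 := SimpleGraph.induce_adj.1 hab
    have haT : a.1 ∈ T.erase v := Finset.mem_erase.2 ⟨ha, Finset.mem_coe.1 a.2⟩
    by_cases hb : b.1 = v
    · rw [hb] at hab'
      obtain ⟨k, hk⟩ := exists_hexNbr_eq hab'.symm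
      refine ⟨k, hk ▸ haT, haT, ⟨SimpleGraph.Walk.nil.copy rfl (Subtype.ext hk.symm)⟩⟩
    · obtain ⟨k, hk, hbT, hr⟩ := ih hc hb
      refine ⟨k, hk, haT, SimpleGraph.Reachable.trans (SimpleGraph.Adj.reachable ?_) hr⟩
      exact SimpleGraph.induce_adj.2 hab'

/-- **Removing a face whose remaining neighbours are mutually joined keeps connectivity.** -/
theorem preconnected_erase_of {T : Finset HexVertex} {v : HexVertex} (hv : v ∈ T)
    (hconn : (hexGraph.induce (↑T : Set HexVertex)).Preconnected)
    (h : ∀ (k k' : Fin 3) (hk : hexNbr v k ∈ T.erase v) (hk' : hexNbr v k' ∈ T.erase v),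
      (hexGraph.induce (↑(T.erase v) : Set HexVertex)).Reachable
        ⟨hexNbr v k, Finset.mem_coe.2 hk⟩ ⟨hexNbr v k', Finset.mem_coe.2 hk'⟩) :
    (hexGraph.induce (↑(T.erase v) : Set HexVertex)).Preconnected := by
  intro x y
  have hx : x.1 ≠ v ∧ x.1 ∈ T := Finset.mem_erase.1 (Finset.mem_coe.1 x.2)
  have hy : y.1 ≠ v ∧ y.1 ∈ T := Finset.mem_erase.1 (Finset.mem_coe.1 y.2)
  obtain ⟨px⟩ := hconn ⟨x.1, Finset.mem_coe.2 hx.2⟩ ⟨v, Finset.mem_coe.2 hv⟩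
  obtain ⟨py⟩ := hconn ⟨y.1, Finset.mem_coe.2 hy.2⟩ ⟨v, Finset.mem_coe.2 hv⟩
  obtain ⟨k, hk, _hxT, hrx⟩ := exists_hexNbr_reachable_erase _ _ px rfl hx.1
  obtain ⟨k', hk', _hyT, hry⟩ := exists_hexNbr_reachable_erase _ _ py rfl hy.1
  exact hrx.trans ((h k k' hk hk').trans hry.symm)

/-- **An isolated face of a connected face set is the whole set.** -/
theorem eq_of_isolated {T : Finset HexVertex} {v : HexVertex} (hv : v ∈ T)
    (hconn : (hexGraph.induce (↑T : Set HexVertex)).Preconnected) (h : ∀ k : Fin 3, hexNbr v k ∉ T)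
    {x : HexVertex} (hx : x ∈ T) : x = v := by
  have key : ∀ (a b : (↑T : Set HexVertex)) (_ : (hexGraph.induce (↑T : Set HexVertex)).Walk a b),
      a.1 = v → b.1 = v := by
    intro a b p
    cases p with
    | nil => exact id
    | @cons _ b' _ hadj _ =>
      intro ha
      obtain ⟨k, hk⟩ := exists_hexNbr_eq (SimpleGraph.induce_adj.1 hadj)
      exact absurd (by rw [← ha, hk]; exact Finset.mem_coe.1 b'.2) (h k)
  obtain ⟨p⟩ := hconn ⟨v, Finset.mem_coe.2 hv⟩ ⟨x, Finset.mem_coe.2 hx⟩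
  exact key _ _ p rfl

/-! ### The components of `T ∖ {v}` -/

/-- A walk of `Λ` ending at `va` stays in the source component. -/
theorem reachable_srcComp_of_walk {Λ : Finset HexVertex} {va : HexVertex} (hva : va ∈ Λ) :
    ∀ (x y : (↑Λ : Set HexVertex)) (_ : (hexGraph.induce (↑Λ : Set HexVertex)).Walk x y),
      y = ⟨va, by simpa using hva⟩ → ∃ hx : x.1 ∈ srcComp Λ va,
        (hexGraph.induce (↑(srcComp Λ va) : Set HexVertex)).Reachable
          ⟨va, by simpa using (mem_srcComp_iff.2 ⟨hva, hva, SimpleGraph.Reachable.refl _⟩ :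
            va ∈ srcComp Λ va)⟩ ⟨x.1, by simpa using hx⟩ := by
  intro x y p
  induction p with
  | nil =>
    rintro rfl
    exact ⟨mem_srcComp_iff.2 ⟨hva, hva, SimpleGraph.Reachable.refl _⟩, SimpleGraph.Reachable.refl _⟩
  | @cons u v w huv _ ih =>
    rintro rfl
    obtain ⟨hv0, hr⟩ := ih rfl
    have hadj' : hexGraph.Adj u.1 v.1 := SimpleGraph.induce_adj.1 huv
    have hu0 : u.1 ∈ srcComp Λ va := mem_srcComp_of_adj hv0 (Finset.mem_coe.1 u.2) hadj'.symm
    exact ⟨hu0, hr.trans (SimpleGraph.Adj.reachable (SimpleGraph.induce_adj.2 hadj'.symm))⟩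

/-- **The source component is connected in `ℍ`.** -/
theorem srcComp_preconnected (Λ : Finset HexVertex) (va : HexVertex) :
    (hexGraph.induce (↑(srcComp Λ va) : Set HexVertex)).Preconnected := by
  intro p q
  have hp : p.1 ∈ srcComp Λ va := Finset.mem_coe.1 p.2
  have hq : q.1 ∈ srcComp Λ va := Finset.mem_coe.1 q.2
  obtain ⟨hva, hpΛ, ⟨wp⟩⟩ := mem_srcComp_iff.1 hp
  obtain ⟨hva', hqΛ, ⟨wq⟩⟩ := mem_srcComp_iff.1 hq
  obtain ⟨hp', hrp⟩ := reachable_srcComp_of_walk hva _ _ wp.reverse rfl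
  obtain ⟨hq', hrq⟩ := reachable_srcComp_of_walk hva' _ _ wq.reverse rfl
  exact hrp.symm.trans hrq

/-- **The components of `T ∖ {v}` hang off the `T`-neighbours of `v`.** If `T` is connected and
the port `a + 2` of `v ∈ T` points outside `T`, every face of `T ∖ {v}` lies in the component of
`hexNbr v a` or in that of `hexNbr v (a+1)`. -/
theorem mem_srcComp_or_of_erase {T : Finset HexVertex} {v : HexVertex} {a : Fin 3} (hv : v ∈ T)
    (hconn : (hexGraph.induce (↑T : Set HexVertex)).Preconnected) (ha2 : hexNbr v (a + 2) ∉ T)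
    {x : HexVertex} (hx : x ∈ T.erase v) :
    x ∈ srcComp (T.erase v) (hexNbr v a) ∨ x ∈ srcComp (T.erase v) (hexNbr v (a + 1)) := by
  have hx' := Finset.mem_erase.1 hx
  obtain ⟨p⟩ := hconn ⟨x, Finset.mem_coe.2 hx'.2⟩ ⟨v, Finset.mem_coe.2 hv⟩
  obtain ⟨k, hk, _hxT, hr⟩ := exists_hexNbr_reachable_erase _ _ p rfl hx'.1
  rcases fin3_trichotomy a k with rfl | rfl | rfl
  · exact Or.inl (mem_srcComp_iff.2 ⟨hk, hx, hr.symm⟩)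
  · exact Or.inr (mem_srcComp_iff.2 ⟨hk, hx, hr.symm⟩)
  · exact absurd (Finset.mem_of_mem_erase hk) ha2

/-! ### Links -/

/-- **The one-face arc at a corner with two outer ports links them.** If the ports `c` and
`c + 1` of `v ∈ T` point outside `T`, the arc `{v}` at the site of the corner `c` of `v` has
out-flank `(v, c+1)` and in-flank `(v, c)`; so a function satisfying the flank condition at every
arc whose out-flank is not `p₀` has `f v (c+1) = f v c` as soon as `(v, c+1) ≠ p₀`. -/
theorem corner_link {T : Finset HexVertex} {f : HexVertex → Fin 3 → ℝ} {p₀ : HexVertex × Fin 3}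
    (hL : ∀ (s : Site 2) (j m : Fin 6), m ≠ 0 → face s j ∉ T →
      (∀ i : Fin 6, i < m → face s (j + 1 + i) ∈ T) → face s (j + 1 + m) ∉ T →
      (face s (j + 1), arcCornerIdx (j + 1) + 1) ≠ p₀ →
      f (face s (j + 1)) (arcCornerIdx (j + 1) + 1) = f (face s (j + m)) (arcCornerIdx (j + m)))
    {v : HexVertex} (c : Fin 3) (hv : v ∈ T) (hc : hexNbr v c ∉ T) (hc1 : hexNbr v (c + 1) ∉ T)
    (hne : (v, c + 1) ≠ p₀) : f v (c + 1) = f v c := by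
  obtain ⟨l, hl, hκ⟩ := s4_exists_face_eq_of_corner v c
  set S := Dev.triVert v (c + 1)
  have h1 : face S (l - 1) ∉ T := by rw [← hexNbr_face_arcCornerIdx_succ, hl, hκ]; exact hc1
  have h3 : face S (l - 1 + 1 + 1) ∉ T := by
    rw [sub_add_cancel, ← hexNbr_face_arcCornerIdx, hl, hκ]; exact hc
  have h2 : ∀ i : Fin 6, i < 1 → face S (l - 1 + 1 + i) ∈ T := by
    intro i hi
    rw [fin6_lt_one i hi, add_zero, sub_add_cancel, hl]; exact hv
  have h := hL S (l - 1) 1 one_ne_zero h1 h2 h3 (by rw [sub_add_cancel, hl, hκ]; exact hne)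
  rwa [sub_add_cancel, hl, hκ] at h

/-- **The three outer ports of an isolated face carry one value** (two of the three corner links
suffice). -/
theorem const_of_isolated {T : Finset HexVertex} {f : HexVertex → Fin 3 → ℝ} {p₀ : HexVertex × Fin 3}
    (hL : ∀ (s : Site 2) (j m : Fin 6), m ≠ 0 → face s j ∉ T →
      (∀ i : Fin 6, i < m → face s (j + 1 + i) ∈ T) → face s (j + 1 + m) ∉ T →
      (face s (j + 1), arcCornerIdx (j + 1) + 1) ≠ p₀ →
      f (face s (j + 1)) (arcCornerIdx (j + 1) + 1) = f (face s (j + m)) (arcCornerIdx (j + m)))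
    {v : HexVertex} (hv : v ∈ T) (h : ∀ k : Fin 3, hexNbr v k ∉ T) (k : Fin 3) : f v k = f v 0 := by
  have Lc : ∀ c : Fin 3, (v, c + 1) ≠ p₀ → f v (c + 1) = f v c :=
    fun c hne => corner_link hL c hv (h c) (h (c + 1)) hne
  have e10 : (v, (1 : Fin 3)) ≠ p₀ → f v 1 = f v 0 := fun hp => by simpa using Lc 0 (by simpa using hp)
  have e21 : (v, (2 : Fin 3)) ≠ p₀ → f v 2 = f v 1 := fun hp => by simpa using Lc 1 (by simpa using hp)
  have e02 : (v, (0 : Fin 3)) ≠ p₀ → f v 0 = f v 2 := fun hp => by simpa using Lc 2 (by simpa using hp)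
  fin_cases k
  · rfl
  · by_cases h1 : (v, (1 : Fin 3)) = p₀
    · have h2 : (v, (2 : Fin 3)) ≠ p₀ := by rw [← h1]; simp
      have h0 : (v, (0 : Fin 3)) ≠ p₀ := by rw [← h1]; simp
      simpa using (e21 h2).symm.trans ((e02 h0).symm)
    · simpa using e10 h1
  · by_cases h0 : (v, (0 : Fin 3)) = p₀
    · have h1 : (v, (1 : Fin 3)) ≠ p₀ := by rw [← h0]; simp
      have h2 : (v, (2 : Fin 3)) ≠ p₀ := by rw [← h0]; simp
      simpa using (e21 h2).trans (e10 h1)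
    · simpa using (e02 h0).symm

/-- **Transfer of the flank condition past a removed face.** Let `X ⊆ T` be closed under
adjacency inside `T ∖ {v}`, `f` satisfy the flank condition of `T` at every arc whose
out-flank is not `p₀`, and `f'` agree with `f` except that it equals `c` on every port pointing into
`v`.  If either `p' = p₀` or the face of `p₀` is not in `X`, and the flank condition of `X` for `f'`
holds at the arcs of `X` starting right after `v` (`hstart`) and ending right before `v` (`hend`),
then `f'` satisfies the flank condition of `X` at every arc whose out-flank is not `p'`. -/
theorem links_transfer {T X : Finset HexVertex} {v : HexVertex} {f f' : HexVertex → Fin 3 → ℝ}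
    {c : ℝ} {p₀ p' : HexVertex × Fin 3} (hXT : X ⊆ T)
    (hcl : ∀ x ∈ X, ∀ y ∈ T, y ≠ v → hexGraph.Adj x y → y ∈ X)
    (hL : ∀ (s : Site 2) (j m : Fin 6), m ≠ 0 → face s j ∉ T →
      (∀ i : Fin 6, i < m → face s (j + 1 + i) ∈ T) → face s (j + 1 + m) ∉ T →
      (face s (j + 1), arcCornerIdx (j + 1) + 1) ≠ p₀ →
      f (face s (j + 1)) (arcCornerIdx (j + 1) + 1) = f (face s (j + m)) (arcCornerIdx (j + m)))
    (hp : p' = p₀ ∨ p₀.1 ∉ X) (hf'v : ∀ x k, hexNbr x k = v → f' x k = c)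
    (hf'n : ∀ x k, hexNbr x k ≠ v → f' x k = f x k)
    (hstart : ∀ (s : Site 2) (j m : Fin 6), m ≠ 0 → face s j = v →
      (∀ i : Fin 6, i < m → face s (j + 1 + i) ∈ X) → face s (j + 1 + m) ∉ X →
      face s (j + 1 + m) ≠ v → (face s (j + 1), arcCornerIdx (j + 1) + 1) ≠ p' →
      c = f (face s (j + m)) (arcCornerIdx (j + m)))
    (hend : ∀ (s : Site 2) (j m : Fin 6), m ≠ 0 → face s j ∉ X → face s j ≠ v →
      (∀ i : Fin 6, i < m → face s (j + 1 + i) ∈ X) → face s (j + 1 + m) = v →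
      (face s (j + 1), arcCornerIdx (j + 1) + 1) ≠ p' →
      f (face s (j + 1)) (arcCornerIdx (j + 1) + 1) = c) :
    ∀ (s : Site 2) (j m : Fin 6), m ≠ 0 → face s j ∉ X →
      (∀ i : Fin 6, i < m → face s (j + 1 + i) ∈ X) → face s (j + 1 + m) ∉ X →
      (face s (j + 1), arcCornerIdx (j + 1) + 1) ≠ p' →
      f' (face s (j + 1)) (arcCornerIdx (j + 1) + 1) = f' (face s (j + m)) (arcCornerIdx (j + m)) := by
  intro s j m hm hj hi hjm hne
  have h0 : (0 : Fin 6) < m := (Fin.pos_iff_ne_zero' m).2 hm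
  have hj1 : face s (j + 1) ∈ X := by simpa using hi 0 h0
  have hmX : face s (j + m) ∈ X := by
    have h := hi (m - 1) (Fin.sub_one_lt_iff.2 h0)
    rwa [show j + 1 + (m - 1) = j + m by abel] at h
  have eout : hexNbr (face s (j + 1)) (arcCornerIdx (j + 1) + 1) = face s j := by
    rw [hexNbr_face_arcCornerIdx_succ, add_sub_cancel_right]
  have ein : hexNbr (face s (j + m)) (arcCornerIdx (j + m)) = face s (j + 1 + m) := by
    rw [hexNbr_face_arcCornerIdx, show j + m + 1 = j + 1 + m by abel]
  by_cases hvj : face s j = v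
  · rw [hf'v _ _ (eout.trans hvj)]
    by_cases hvl : face s (j + 1 + m) = v
    · rw [hf'v _ _ (ein.trans hvl)]
    · rw [hf'n _ _ (fun h => hvl (ein.symm.trans h))]
      exact hstart s j m hm hvj hi hjm hvl hne
  · rw [hf'n _ _ (fun h => hvj (eout.symm.trans h))]
    by_cases hvl : face s (j + 1 + m) = v
    · rw [hf'v _ _ (ein.trans hvl)]
      exact hend s j m hm hj hvj hi hvl hne
    · rw [hf'n _ _ (fun h => hvl (ein.symm.trans h))]
      have hjT : face s j ∉ T := fun h =>
        hj (hcl _ hj1 _ h hvj (by simpa using StepLaw.adj_face_pred s (j + 1)))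
      have hlT : face s (j + 1 + m) ∉ T := fun h =>
        hjm (hcl _ hmX _ h hvl (by
          have h' := StepLaw.adj_face_succ s (j + m)
          rwa [show j + m + 1 = j + 1 + m by abel] at h'))
      refine hL s j m hm hjT (fun i hi' => hXT (hi i hi')) hlT ?_
      rcases hp with rfl | hp
      · exact hne
      · exact fun h => hp (by rw [← h]; exact hj1)

end Xi

end Summit.CriticalPhenomena.SAWScalingLimit.Cruxes.QCIdentification.EightFifthsPrimitive

end
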